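import Mathlib
import Summits.AtomisticToContinuum.HydrodynamicLimit.Theorems.ImplosionDichotomyDenseExcursionR2SelfSimilar

/-!
# Isentropic reduction of the self-similar hard-sphere Euler system — stub `stub_isentropicReduction` (W2)

Crux `Summit.AtomisticToContinuum.HydrodynamicLimit.Theses.ImplosionDichotomy.DenseExcursion`
(stmt-AtomisticToContinuum-12586), line `r2-one-mode-two-conditions`, registered stub
`stub_isentropicReduction : IsentropicReduction` (defs module
`…Theorems.ImplosionDichotomyDenseExcursionR2SelfSimilar`).

**Mathematics.** Off the centre (`ζ ≠ 0`) write `q = ‖ζ‖`, `p = logPt (τ, ζ) = (τ, log q)`, `' = ∂ₓ`,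
`s = sf(p)`, `W = w(p)`. The radial point map has `D(logPt)(τ, ζ)(a, η) = (a, ⟪ζ, η⟫/q²)`, whence for `F`
differentiable at `p`: `∂_τ(F ∘ logPt) = F_τ(p)`, `∂ᵢ(F ∘ logPt) = (ζᵢ/q²) F'(p)` (`isen_logPt_chain`), so
`Σᵢ ζᵢ ∂ᵢ(F ∘ logPt) = F'`; and `∂_τ‖ζ‖ⁿ = 0`, `∂ᵢ‖ζ‖ⁿ = n‖ζ‖ⁿζᵢ/q²` (`isen_normPow_fderiv`, via
`‖ζ‖ⁿ = exp(n log‖ζ‖) = expₙ ∘ logPt` near `z`), `∇·ζ = 3`. In the IDEAL case `Z ≡ 1` the diameter `D` drops out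
of the pressure `𝒫 Θ̂ Z(𝒫 D³) = 𝒫 Θ̂` and the heating `H Θ̂ (Z - 1)` vanishes. For the isentropic radial fields
`𝒫 = C q³ (sf ∘ logPt)³`, `𝒱 = -(w ∘ logPt) ζ`, `Θ̂ = (3/5) q² (sf ∘ logPt)²`:
* mass residual `= 3 C q³ s² · (s_τ - ((W-1)s' + (s/3)W' + s(2W - r)))` (`isen_mass`);
* `j`-th momentum residual `= -(ζⱼ C q³ s³) · (W_τ - ((W-1)W' + 3 s s' + W² - rW + 3 s²))` (`isen_momentum`;
  pressure gradient `∇((3/5) C q⁵ s⁵) = 3 C q³ s⁴ (s + s') ζ`);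
* temperature residual `= (6/5) q² s · (s_τ - ((W-1)s' + (s/3)W' + s(2W - r)))` (`isen_temperature`) — the SAME
  bracket as the mass equation: the isentropic ansatz is consistent.
Hence, for `C > 0`, `s > 0`, (mass ∧ momentum ∧ temperature) ⇔ (`w`-equation ∧ `sf`-equation)
(`stub_isentropicReduction`; momentum: if `W_τ - rhs ≠ 0` every `ζⱼ` vanishes, contradicting `ζ ≠ 0`).
In the final algebra `‖ζ‖³` is kept as an atom (every residual is linear in it), `‖ζ‖²` is written
`ζ₀² + ζ₁² + ζ₂²` (`isen_coords`), and the identities close by `field_simp; ring`. Every lemma below is folklore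
calculus (template: the sibling stub W4 `stub_radialReduction` and the landed `Theorems.KidderKnobMelnikov.dual_*`
identities).
-/

noncomputable section

open Filter Set
open scoped Topology ContDiff RealInnerProductSpace

namespace Summit.AtomisticToContinuum.HydrodynamicLimit.Theorems.R2OneModeTwoConditions

open Literature.MathematicalPhysics.KineticTheory (V3)

open Summit.AtomisticToContinuum.HydrodynamicLimit.Theorems.KidderKnobMelnikov

/-! ## Calculus off the centre: the radial point map `logPt` and the powers `‖ζ‖ⁿ` -/

section Calculus

variable {G : Type*} [NormedAddCommGroup G] [NormedSpace ℝ G] {z : ℝ × V3}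

/-- **Chain rule through `logPt`, off the centre.** For `F` differentiable at `logPt z`, `ζ ≠ 0`:
`F ∘ logPt` is differentiable at `z`, `∂_τ (F ∘ logPt)(z) = (∂_τ F)(logPt z)` and
`∂ᵢ (F ∘ logPt)(z) = (ζᵢ / ‖ζ‖²) (∂ₓ F)(logPt z)` (`D(logPt)(τ, ζ)(a, η) = (a, ⟪ζ, η⟫ / ‖ζ‖²)`, from
`D‖ζ‖² = 2⟪ζ, ·⟫` and `log ‖ζ‖ = ½ log ‖ζ‖²`). [folklore] -/
theorem isen_logPt_chain {F : ℝ × ℝ → G} (hz : z.2 ≠ 0) (hF : DifferentiableAt ℝ F (logPt z)) :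
    HasFDerivAt (fun w => F (logPt w)) (fderiv ℝ (fun w => F (logPt w)) z) z ∧
      fderiv ℝ (fun w => F (logPt w)) z (1, 0) = fderiv ℝ F (logPt z) (1, 0) ∧
      ∀ i : Fin 3, fderiv ℝ (fun w => F (logPt w)) z (0, EuclideanSpace.single i 1) =
        (z.2 i / ‖z.2‖ ^ 2) • fderiv ℝ F (logPt z) (0, 1) := by
  have hq : ‖z.2‖ ^ 2 ≠ 0 := pow_ne_zero 2 (norm_ne_zero_iff.mpr hz)
  -- `D(‖ζ‖²)(τ, ζ)(a, η) = 2⟪ζ, η⟫`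
  have h2 : HasFDerivAt (fun w : ℝ × V3 => ‖w.2‖ ^ 2)
      ((2 : ℝ) • (innerSL ℝ z.2).comp (ContinuousLinearMap.snd ℝ ℝ V3)) z := by
    have h := (hasStrictFDerivAt_norm_sq z.2).hasFDerivAt.comp z hasFDerivAt_snd
    refine h.congr_fderiv (ContinuousLinearMap.ext fun v => ?_)
    simp [two_smul]
  -- `D(log ‖ζ‖)(τ, ζ)(a, η) = ⟪ζ, η⟫ / ‖ζ‖²`
  have hlog : HasFDerivAt (fun w : ℝ × V3 => Real.log ‖w.2‖)
      ((‖z.2‖ ^ 2)⁻¹ • (innerSL ℝ z.2).comp (ContinuousLinearMap.snd ℝ ℝ V3)) z := by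
    have h := (h2.log hq).const_mul (2⁻¹ : ℝ)
    have heq : (fun w : ℝ × V3 => 2⁻¹ * Real.log (‖w.2‖ ^ 2)) = fun w => Real.log ‖w.2‖ := by
      funext w
      rw [Real.log_pow]
      push_cast
      ring
    rw [heq] at h
    refine h.congr_fderiv (ContinuousLinearMap.ext fun v => ?_)
    simp only [smul_apply, smul_eq_mul]
    ring
  -- chain rule
  have hc : HasFDerivAt (fun w => F (logPt w))
      ((fderiv ℝ F (logPt z)).comp ((ContinuousLinearMap.fst ℝ ℝ V3).prod
        ((‖z.2‖ ^ 2)⁻¹ • (innerSL ℝ z.2).comp (ContinuousLinearMap.snd ℝ ℝ V3)))) z :=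
    hF.hasFDerivAt.comp z (hasFDerivAt_fst.prodMk hlog)
  refine ⟨hc.differentiableAt.hasFDerivAt, ?_, fun i => ?_⟩
  · rw [hc.fderiv]
    simp
  · rw [hc.fderiv]
    simp only [ContinuousLinearMap.coe_comp, Function.comp_apply, ContinuousLinearMap.prod_apply,
      ContinuousLinearMap.coe_fst', smul_apply, ContinuousLinearMap.coe_snd', innerSL_apply_apply,
      EuclideanSpace.inner_single_right, conj_trivial, one_mul, smul_eq_mul]
    -- `L (0, c) = c • L (0, 1)` on `ℝ × ℝ`
    rw [← map_smul, div_eq_inv_mul]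
    exact congrArg _ (Prod.ext (by simp) (by simp))

/-- **Powers of the radius, off the centre.** `w ↦ ‖w.2‖ⁿ` is differentiable at `z` (`ζ ≠ 0`) with
`∂_τ ‖ζ‖ⁿ = 0` and `∂ᵢ ‖ζ‖ⁿ = n ‖ζ‖ⁿ ζᵢ / ‖ζ‖²` (near `z`, `‖ζ‖ⁿ = exp(n log ‖ζ‖)` is a function of `logPt`;
the factor is written with `‖ζ‖ⁿ / ‖ζ‖²` so that odd powers stay atoms of the final algebra). [folklore] -/
theorem isen_normPow_fderiv (hz : z.2 ≠ 0) (n : ℕ) :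
    HasFDerivAt (fun w : ℝ × V3 => ‖w.2‖ ^ n) (fderiv ℝ (fun w : ℝ × V3 => ‖w.2‖ ^ n) z) z ∧
      fderiv ℝ (fun w : ℝ × V3 => ‖w.2‖ ^ n) z (1, 0) = 0 ∧
      ∀ i : Fin 3, fderiv ℝ (fun w : ℝ × V3 => ‖w.2‖ ^ n) z (0, EuclideanSpace.single i 1) =
        n * ‖z.2‖ ^ n / ‖z.2‖ ^ 2 * z.2 i := by
  -- the one-variable function `expₙ (τ, x) = exp (n x)` and its derivative at `logPt z`
  have hE : HasFDerivAt (fun p : ℝ × ℝ => Real.exp (↑n * p.2))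
      (Real.exp (↑n * (logPt z).2) • ((n : ℝ) • ContinuousLinearMap.snd ℝ ℝ ℝ)) (logPt z) :=
    ((hasFDerivAt_snd (E := ℝ) (F := ℝ)).const_mul (n : ℝ)).exp
  have hexp : ∀ y : ℝ × V3, y.2 ≠ 0 → Real.exp (↑n * Real.log ‖y.2‖) = ‖y.2‖ ^ n := fun y hy => by
    rw [← Real.log_pow]
    exact Real.exp_log (pow_pos (norm_pos_iff.mpr hy) n)
  have hz' : Real.exp (↑n * (logPt z).2) = ‖z.2‖ ^ n := hexp z hz
  -- near `z` the power is `expₙ ∘ logPt`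
  have hev : (fun w : ℝ × V3 => ‖w.2‖ ^ n) =ᶠ[𝓝 z] fun w => Real.exp (↑n * (logPt w).2) := by
    filter_upwards [continuous_snd.continuousAt.eventually_ne hz] with y hy
    exact (hexp y hy).symm
  obtain ⟨h1, h2, h3⟩ := isen_logPt_chain (F := fun p : ℝ × ℝ => Real.exp (↑n * p.2)) hz hE.differentiableAt
  rw [hE.fderiv] at h2 h3
  have hfd : fderiv ℝ (fun w : ℝ × V3 => ‖w.2‖ ^ n) z = fderiv ℝ (fun w => Real.exp (↑n * (logPt w).2)) z :=
    hev.fderiv_eq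
  refine ⟨(h1.congr_of_eventuallyEq hev).congr_fderiv hfd.symm, ?_, fun i => ?_⟩
  · rw [hfd, h2]
    simp
  · rw [hfd, h3 i]
    simp only [smul_apply, ContinuousLinearMap.coe_snd', smul_eq_mul, mul_one, hz']
    ring

/-- `‖ζ‖² = ζ₀² + ζ₁² + ζ₂² ≠ 0` off the centre. [folklore] -/
theorem isen_coords (hz : z.2 ≠ 0) :
    ‖z.2‖ ^ 2 = z.2 0 ^ 2 + z.2 1 ^ 2 + z.2 2 ^ 2 ∧ z.2 0 ^ 2 + z.2 1 ^ 2 + z.2 2 ^ 2 ≠ 0 := by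
  have hn : ‖z.2‖ ^ 2 = z.2 0 ^ 2 + z.2 1 ^ 2 + z.2 2 ^ 2 := by
    rw [EuclideanSpace.norm_sq_eq, Fin.sum_univ_three]
    simp only [Real.norm_eq_abs, sq_abs]
  exact ⟨hn, hn ▸ pow_ne_zero 2 (norm_ne_zero_iff.mpr hz)⟩

end Calculus

/-! ## The isentropic radial fields -/

section Fields

/-- `isenDensity C sf = C ‖ζ‖³ (sf ∘ logPt)³`, as a lambda. [folklore] -/
theorem isen_isenDensity_eq (C : ℝ) (sf : ℝ × ℝ → ℝ) :
    isenDensity C sf = fun y => C * ‖y.2‖ ^ 3 * sf (logPt y) ^ 3 := rfl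

/-- `isenTemperature sf = (3/5) ‖ζ‖² (sf ∘ logPt)²`, as a lambda. [folklore] -/
theorem isen_isenTemperature_eq (sf : ℝ × ℝ → ℝ) :
    isenTemperature sf = fun y => 3 / 5 * ‖y.2‖ ^ 2 * sf (logPt y) ^ 2 := rfl

end Fields

/-! ## The three residual identities of the ideal isentropic system -/

section Identities

variable {z : ℝ × V3} {w sf : ℝ × ℝ → ℝ}

/-- **Mass.** For the isentropic radial fields the self-similar mass residual
`∂_τ𝒫 + ∇·(𝒫(𝒱 + ζ)) + (3r-6)𝒫` equals `3 C ‖ζ‖³ sf² · (sf_τ - ((w-1)sf' + (sf/3)w' + sf(2w - r)))` at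
`logPt z`. [folklore] -/
theorem isen_mass (hz : z.2 ≠ 0) (hw : DifferentiableAt ℝ w (logPt z))
    (hsf : DifferentiableAt ℝ sf (logPt z)) (r C : ℝ) :
    dT (isenDensity C sf) z + ∑ i, dX i (fun y => isenDensity C sf y * (radVelocity w y i + y.2 i)) z +
        (3 * r - 6) * isenDensity C sf z =
      3 * C * ‖z.2‖ ^ 3 * sf (logPt z) ^ 2 * (dτ sf (logPt z) -
        ((w (logPt z) - 1) * dx sf (logPt z) + sf (logPt z) / 3 * dx w (logPt z) +
          sf (logPt z) * (2 * w (logPt z) - r))) := by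
  obtain ⟨hS, hSt, hSx⟩ := isen_logPt_chain hz hsf
  obtain ⟨hW, -, hWx⟩ := isen_logPt_chain hz hw
  obtain ⟨hN, hNt, hNx⟩ := isen_normPow_fderiv hz 3
  have hP : HasFDerivAt (fun y : ℝ × V3 => C * ‖y.2‖ ^ 3 * sf (logPt y) ^ 3) _ z :=
    (hN.const_mul C).fun_mul (hS.pow 3)
  have hDV := fun i =>
    (hP.fun_mul ((hW.fun_neg.fun_mul (hasFDerivAt_coord z i)).fun_add (hasFDerivAt_coord z i))).fderiv
  unfold dT dX dτ dx
  simp only [isen_isenDensity_eq, radVelocity, PiLp.smul_apply, smul_eq_mul]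
  simp only [hDV, hP.fderiv]
  simp only [add_apply, smul_apply, neg_apply, ContinuousLinearMap.coe_comp, Function.comp_apply,
    ContinuousLinearMap.coe_snd', PiLp.proj_apply, hNt, hNx, hSt, hSx, hWx, smul_eq_mul, nsmul_eq_mul,
    mul_zero, add_zero]
  simp only [Fin.sum_univ_three, PiLp.single_apply]
  generalize ‖z.2‖ ^ 3 = Q
  obtain ⟨hn, h0⟩ := isen_coords hz
  simp only [hn]
  generalize fderiv ℝ sf (logPt z) (1, 0) = St
  generalize fderiv ℝ sf (logPt z) (0, 1) = Sx
  generalize fderiv ℝ w (logPt z) (0, 1) = Wx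
  norm_num
  field_simp
  ring

/-- **Momentum** (`j`-th component, ideal gas `Z ≡ 1`, so the pressure is `𝒫 Θ̂ = (3/5) C ‖ζ‖⁵ sf⁵`). For the
isentropic radial fields the self-similar momentum residual is
`-(ζⱼ C ‖ζ‖³ sf³) · (w_τ - ((w-1)w' + 3 sf sf' + w² - rw + 3 sf²))` at `logPt z`: every term is a multiple
of `ζⱼ` (`∇((3/5) C ‖ζ‖⁵ sf⁵) = 3 C ‖ζ‖³ sf⁴ (sf + sf') ζ`). [folklore] -/
theorem isen_momentum (hz : z.2 ≠ 0) (hw : DifferentiableAt ℝ w (logPt z))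
    (hsf : DifferentiableAt ℝ sf (logPt z)) (r C : ℝ) (j : Fin 3) :
    isenDensity C sf z * (dT (fun y => radVelocity w y j) z + (r - 1) * radVelocity w z j +
          ∑ i, (z.2 i + radVelocity w z i) * dX i (fun y => radVelocity w y j) z) +
        dX j (fun y => isenDensity C sf y * isenTemperature sf y) z =
      -(z.2 j * (C * ‖z.2‖ ^ 3 * sf (logPt z) ^ 3)) * (dτ w (logPt z) -
        ((w (logPt z) - 1) * dx w (logPt z) + 3 * sf (logPt z) * dx sf (logPt z) +
          w (logPt z) ^ 2 - r * w (logPt z) + 3 * sf (logPt z) ^ 2)) := by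
  obtain ⟨hS, -, hSx⟩ := isen_logPt_chain hz hsf
  obtain ⟨hW, hWt, hWx⟩ := isen_logPt_chain hz hw
  obtain ⟨hN3, -, hN3x⟩ := isen_normPow_fderiv hz 3
  obtain ⟨hN2, -, hN2x⟩ := isen_normPow_fderiv hz 2
  have hP : HasFDerivAt (fun y : ℝ × V3 => C * ‖y.2‖ ^ 3 * sf (logPt y) ^ 3) _ z :=
    (hN3.const_mul C).fun_mul (hS.pow 3)
  have hT : HasFDerivAt (fun y : ℝ × V3 => 3 / 5 * ‖y.2‖ ^ 2 * sf (logPt y) ^ 2) _ z :=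
    (hN2.const_mul (3 / 5 : ℝ)).fun_mul (hS.pow 2)
  have hPr : HasFDerivAt (fun y : ℝ × V3 =>
      C * ‖y.2‖ ^ 3 * sf (logPt y) ^ 3 * (3 / 5 * ‖y.2‖ ^ 2 * sf (logPt y) ^ 2)) _ z :=
    hP.fun_mul hT
  have hVd := fun j => (hW.fun_neg.fun_mul (hasFDerivAt_coord z j)).fderiv
  unfold dT dX dτ dx
  simp only [isen_isenDensity_eq, isen_isenTemperature_eq, radVelocity, PiLp.smul_apply, smul_eq_mul]
  simp only [hVd, hPr.fderiv]
  simp only [add_apply, smul_apply, neg_apply, ContinuousLinearMap.coe_comp, Function.comp_apply,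
    ContinuousLinearMap.coe_snd', PiLp.proj_apply, hN3x, hN2x, hWt, hWx, hSx, smul_eq_mul, nsmul_eq_mul]
  simp only [PiLp.single_apply, mul_ite, mul_one, mul_zero, mul_add, add_mul, Finset.sum_add_distrib,
    Finset.sum_ite_eq, Finset.mem_univ, if_true]
  simp only [Fin.sum_univ_three]
  generalize ‖z.2‖ ^ 3 = Q
  obtain ⟨hn, h0⟩ := isen_coords hz
  simp only [hn]
  generalize fderiv ℝ w (logPt z) (1, 0) = Wt
  generalize fderiv ℝ w (logPt z) (0, 1) = Wx
  generalize fderiv ℝ sf (logPt z) (0, 1) = Sx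
  norm_num
  field_simp
  ring

/-- **Temperature** (ideal gas `Z ≡ 1`: no real-gas factor, no heating). For the isentropic radial fields the
self-similar temperature residual is `(6/5) ‖ζ‖² sf · (sf_τ - ((w-1)sf' + (sf/3)w' + sf(2w - r)))` at
`logPt z` — the same bracket as the mass residual (`isen_mass`): the isentropic ansatz is consistent.
[folklore] -/
theorem isen_temperature (hz : z.2 ≠ 0) (hw : DifferentiableAt ℝ w (logPt z))
    (hsf : DifferentiableAt ℝ sf (logPt z)) (r : ℝ) :
    dT (isenTemperature sf) z + 2 * (r - 1) * isenTemperature sf z +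
          ∑ i, (z.2 i + radVelocity w z i) * dX i (isenTemperature sf) z +
        2 / 3 * isenTemperature sf z * ∑ i, dX i (fun y => radVelocity w y i) z =
      6 / 5 * ‖z.2‖ ^ 2 * sf (logPt z) * (dτ sf (logPt z) -
        ((w (logPt z) - 1) * dx sf (logPt z) + sf (logPt z) / 3 * dx w (logPt z) +
          sf (logPt z) * (2 * w (logPt z) - r))) := by
  obtain ⟨hS, hSt, hSx⟩ := isen_logPt_chain hz hsf
  obtain ⟨hW, -, hWx⟩ := isen_logPt_chain hz hw
  obtain ⟨hN2, hN2t, hN2x⟩ := isen_normPow_fderiv hz 2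
  have hT : HasFDerivAt (fun y : ℝ × V3 => 3 / 5 * ‖y.2‖ ^ 2 * sf (logPt y) ^ 2) _ z :=
    (hN2.const_mul (3 / 5 : ℝ)).fun_mul (hS.pow 2)
  have hVd := fun j => (hW.fun_neg.fun_mul (hasFDerivAt_coord z j)).fderiv
  unfold dT dX dτ dx
  simp only [isen_isenTemperature_eq, radVelocity, PiLp.smul_apply, smul_eq_mul]
  simp only [hVd, hT.fderiv]
  simp only [add_apply, smul_apply, neg_apply, ContinuousLinearMap.coe_comp, Function.comp_apply,
    ContinuousLinearMap.coe_snd', PiLp.proj_apply, hN2t, hN2x, hSt, hSx, hWx, smul_eq_mul, nsmul_eq_mul,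
    mul_zero, add_zero]
  simp only [Fin.sum_univ_three, PiLp.single_apply]
  obtain ⟨hn, h0⟩ := isen_coords hz
  simp only [hn]
  generalize fderiv ℝ sf (logPt z) (1, 0) = St
  generalize fderiv ℝ w (logPt z) (0, 1) = Wx
  generalize fderiv ℝ sf (logPt z) (0, 1) = Sx
  norm_num
  field_simp
  ring

end Identities

/-! ## The reduction -/

/-- **STUB W2 of the line `r2-one-mode-two-conditions` (`stub_isentropicReduction`), PROVED.** Off the centre
(`ζ ≠ 0`), for `(w, sf)(τ, x)` differentiable at `p = (τ, log ‖ζ‖)` with `sf(p) > 0`, `C > 0`, the IDEAL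
(`Z ≡ 1`; the diameter `D` and the heating `H` drop out) self-similar hard-sphere Euler system for the isentropic
radial fields `𝒫 = C‖ζ‖³sf³`, `𝒱 = -w ζ`, `Θ̂ = (3/5)‖ζ‖²sf²` holds at `(τ, ζ)` iff the planner's two equations
`w_τ = (w-1)w' + 3 sf sf' + w² - rw + 3 sf²`, `sf_τ = (w-1)sf' + (sf/3)w' + sf(2w - r)` hold at `p`. Mass and
temperature residuals are the nonzero multiples `3C‖ζ‖³sf²`, `(6/5)‖ζ‖²sf` of `sf_τ - rhs_sf`; the `j`-th momentum
residual is `-(ζⱼ C‖ζ‖³sf³)(w_τ - rhs_w)` and some `ζⱼ ≠ 0`. [folklore] -/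
theorem stub_isentropicReduction : IsentropicReduction := by
  intro r C D H w sf z hz hC hw hsf hpos
  have hq2 : ‖z.2‖ ^ 2 ≠ 0 := pow_ne_zero 2 (norm_ne_zero_iff.mpr hz)
  have hq3 : ‖z.2‖ ^ 3 ≠ 0 := pow_ne_zero 3 (norm_ne_zero_iff.mpr hz)
  have hM : 3 * C * ‖z.2‖ ^ 3 * sf (logPt z) ^ 2 ≠ 0 :=
    mul_ne_zero (mul_ne_zero (mul_ne_zero three_ne_zero hC.ne') hq3) (pow_ne_zero 2 hpos.ne')
  have hΘ : 6 / 5 * ‖z.2‖ ^ 2 * sf (logPt z) ≠ 0 :=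
    mul_ne_zero (mul_ne_zero (by norm_num) hq2) hpos.ne'
  have hP : C * ‖z.2‖ ^ 3 * sf (logPt z) ^ 3 ≠ 0 :=
    mul_ne_zero (mul_ne_zero hC.ne' hq3) (pow_ne_zero 3 hpos.ne')
  have key : ∀ {a b c : ℝ}, a ≠ 0 → (a * (b - c) = 0 ↔ b = c) := fun ha => by
    rw [mul_eq_zero, sub_eq_zero, or_iff_right ha]
  unfold SelfSimEulerZAt
  simp only [mul_one, sub_self, mul_zero]
  rw [isen_mass hz hw hsf r C, isen_temperature hz hw hsf r, key hM, key hΘ]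
  constructor
  · rintro ⟨hs, hm, -⟩
    refine ⟨?_, hs⟩
    by_contra hX
    apply hq2
    have hj : ∀ j, z.2 j = 0 := fun j => by
      have := hm j
      rw [isen_momentum hz hw hsf r C j, mul_eq_zero, neg_eq_zero, mul_eq_zero, sub_eq_zero] at this
      rcases this with (h1 | h1) | h1
      · exact h1
      · exact absurd h1 hP
      · exact absurd h1 hX
    rw [(isen_coords hz).1, hj 0, hj 1, hj 2]
    norm_num
  · rintro ⟨hwE, hs⟩
    refine ⟨hs, fun j => ?_, hs⟩
    rw [isen_momentum hz hw hsf r C j, hwE, sub_self, mul_zero]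

end Summit.AtomisticToContinuum.HydrodynamicLimit.Theorems.R2OneModeTwoConditions

end
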